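import Summits.PneNP.PneNP.Theorems.SymmetryBudgetWindowBarrierEntropyGameTransfer

/-!
# Refinement operators from monotone deflationary steps (greatest-fixed-point closure)

Route `PneNP/SymmetryBudget`, dichotomy `WindowBarrier` (stmt-PneNP-2145) / `NoHiddenOrder` (stmt-PneNP-14781);
companion of `…EntropyGameTransfer.lean`.

The transfer lemma is stated for a `Refinement` (monotone, deflationary, idempotent operator on `Setoid α`).
Concrete refinement procedures are usually given as a STEP that is only monotone and deflationary — e.g. the
Corneil–Goldberg step "equitable refinement, then split every cell by all sections" (Laubner 2011, ch. 3), whose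
monotonicity rests on: a section of a coarser stable partition is a section of every finer one. This file supplies
the abstract passage from such a step to a `Refinement`:

* `Refinement.ofStep f` — for a monotone deflationary `f` on a complete lattice of equivalence relations,
  `s ↦ sSup {q | q ≤ s ∧ f q = q}` is the greatest fixed point of `f` below `s`; it is a fixed point
  (`f (sSup F) ≥ sSup F` by monotonicity, `≤` by deflation), hence monotone, deflationary and idempotent;
* `Refinement.ofStep_le_of_fixed` — every fixed point of `f` below `s` lies below `(ofStep f).R s`
  (the comparison principle used to show that a canonical, individualisation-free run which gets stuck would
  contradict `R (ker c) = ⊥`);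
* `Refinement.iterate_le_ofStep` / `ofStep_eq_iterate_of_fixed` — the closure dominates every iterate
  `f^[k] s`, and equals it as soon as the iterate is a fixed point (the finite, algorithmic description).
-/

-- `Summit.PneNP.PneNP.…` duplicates `PneNP` BY DESIGN (single-problem summit, D-0017).
set_option linter.dupNamespace false

namespace Summit.PneNP.PneNP.Theorems.CosetGame

namespace Refinement

variable {α : Type*}

/-- The set of fixed points of `f` below `s`. -/
def fixedBelow (f : Setoid α → Setoid α) (s : Setoid α) : Set (Setoid α) := {q | q ≤ s ∧ f q = q}

/-- Membership in `fixedBelow`. -/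
theorem mem_fixedBelow {f : Setoid α → Setoid α} {s q : Setoid α} :
    q ∈ fixedBelow f s ↔ q ≤ s ∧ f q = q := Iff.rfl

/-- The greatest fixed point of a monotone deflationary `f` below `s` is a fixed point. -/
theorem f_sSup_fixedBelow {f : Setoid α → Setoid α} (hmono : Monotone f) (hdefl : ∀ s, f s ≤ s)
    (s : Setoid α) : f (sSup (fixedBelow f s)) = sSup (fixedBelow f s) := by
  refine le_antisymm (hdefl _) (sSup_le fun q hq => ?_)
  calc q = f q := hq.2.symm
    _ ≤ f (sSup (fixedBelow f s)) := hmono (le_sSup hq)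

/-- The greatest fixed point below `s` lies below `s`. -/
theorem sSup_fixedBelow_le {f : Setoid α → Setoid α} (s : Setoid α) : sSup (fixedBelow f s) ≤ s :=
  sSup_le fun _ hq => hq.1

/-- **Refinement operator generated by a monotone deflationary step**: `s ↦` the greatest fixed point of
`f` below `s`. -/
def ofStep (f : Setoid α → Setoid α) (hmono : Monotone f) (hdefl : ∀ s, f s ≤ s) : Refinement α where
  R s := sSup (fixedBelow f s)
  le_self s := sSup_fixedBelow_le s
  mono s s' h := sSup_le_sSup fun q hq => ⟨hq.1.trans h, hq.2⟩
  idem s := by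
    refine le_antisymm (sSup_fixedBelow_le _) (le_sSup ⟨le_rfl, ?_⟩)
    exact f_sSup_fixedBelow hmono hdefl s

/-- Unfolding `ofStep`. -/
theorem ofStep_R (f : Setoid α → Setoid α) (hmono : Monotone f) (hdefl : ∀ s, f s ≤ s) (s : Setoid α) :
    (ofStep f hmono hdefl).R s = sSup (fixedBelow f s) := rfl

/-- The closure is a fixed point of the step. -/
theorem f_ofStep (f : Setoid α → Setoid α) (hmono : Monotone f) (hdefl : ∀ s, f s ≤ s) (s : Setoid α) :
    f ((ofStep f hmono hdefl).R s) = (ofStep f hmono hdefl).R s :=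
  f_sSup_fixedBelow hmono hdefl s

/-- **Comparison principle**: every fixed point of the step below `s` lies below the closure of `s`. -/
theorem ofStep_le_of_fixed (f : Setoid α → Setoid α) (hmono : Monotone f) (hdefl : ∀ s, f s ≤ s)
    {s q : Setoid α} (hqs : q ≤ s) (hq : f q = q) : q ≤ (ofStep f hmono hdefl).R s :=
  le_sSup ⟨hqs, hq⟩

/-- In particular: if the closure of `s` is discrete, every fixed point of the step below `s` is discrete
(a stuck canonical run below `s` is impossible). -/
theorem eq_bot_of_fixed_of_ofStep_eq_bot (f : Setoid α → Setoid α) (hmono : Monotone f)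
    (hdefl : ∀ s, f s ≤ s) {s q : Setoid α} (hbot : (ofStep f hmono hdefl).R s = ⊥) (hqs : q ≤ s)
    (hq : f q = q) : q = ⊥ :=
  le_bot_iff.1 (hbot ▸ ofStep_le_of_fixed f hmono hdefl hqs hq)

/-- The closure lies below every iterate of the step. -/
theorem ofStep_le_iterate (f : Setoid α → Setoid α) (hmono : Monotone f) (hdefl : ∀ s, f s ≤ s)
    (s : Setoid α) : ∀ k : ℕ, (ofStep f hmono hdefl).R s ≤ f^[k] s
  | 0 => sSup_fixedBelow_le s
  | k + 1 => by
    rw [Function.iterate_succ_apply']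
    calc (ofStep f hmono hdefl).R s = f ((ofStep f hmono hdefl).R s) := (f_ofStep f hmono hdefl s).symm
      _ ≤ f (f^[k] s) := hmono (ofStep_le_iterate f hmono hdefl s k)

/-- Iterates of a deflationary step stay below the start. -/
theorem iterate_le (f : Setoid α → Setoid α) (hdefl : ∀ s, f s ≤ s) (s : Setoid α) :
    ∀ k : ℕ, f^[k] s ≤ s
  | 0 => le_rfl
  | k + 1 => by
    rw [Function.iterate_succ_apply']
    exact (hdefl _).trans (iterate_le f hdefl s k)

/-- **Algorithmic description**: as soon as an iterate of the step is a fixed point, it IS the closure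
(on a finite lattice this happens after finitely many steps). -/
theorem ofStep_eq_iterate_of_fixed (f : Setoid α → Setoid α) (hmono : Monotone f) (hdefl : ∀ s, f s ≤ s)
    (s : Setoid α) {k : ℕ} (hk : f (f^[k] s) = f^[k] s) : (ofStep f hmono hdefl).R s = f^[k] s :=
  le_antisymm (ofStep_le_iterate f hmono hdefl s k) (ofStep_le_of_fixed f hmono hdefl (iterate_le f hdefl s k) hk)

/-- The intersection of two refinement STEPS (e.g. "equitable refinement" and "split by all sections") is again
monotone and deflationary, so `ofStep` applies to combined steps. -/
theorem monotone_inf_step {f g : Setoid α → Setoid α} (hf : Monotone f) (hg : Monotone g) :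
    Monotone fun s => f s ⊓ g s := fun _ _ h => inf_le_inf (hf h) (hg h)

/-- Deflation of a combined step. -/
theorem inf_step_le {f g : Setoid α → Setoid α} (hf : ∀ s, f s ≤ s) (s : Setoid α) : f s ⊓ g s ≤ s :=
  inf_le_left.trans (hf s)

/-- Composition of monotone deflationary steps is monotone and deflationary (e.g. "refine, then section"). -/
theorem comp_step {f g : Setoid α → Setoid α} (hf : Monotone f) (hg : Monotone g) (hf' : ∀ s, f s ≤ s)
    (hg' : ∀ s, g s ≤ s) : Monotone (f ∘ g) ∧ ∀ s, (f ∘ g) s ≤ s :=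
  ⟨hf.comp hg, fun s => (hf' _).trans (hg' s)⟩

end Refinement

end Summit.PneNP.PneNP.Theorems.CosetGame
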